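import Literature.IUT.HodgeTheaters.ConventionsCatIsomorphismKinds
import Mathlib.CategoryTheory.Endomorphism
import Mathlib.Algebra.Group.Subgroup.Ker
import HarnessLib

/-!
# [IUTchI] §0 / Cor 5.3 (ii): the «LIFT KIND» — the minimal `ℱ`-slot record of an `ℱ`-prime-strip kit whose base functor
# lands in a GIVEN ambient, carrying the Frobenioid's §0-isomorphisms lying over the ambient's (L5 base-merge race, racer B)

S. Mochizuki, *Inter-universal Teichmüller theory I*, kurims manuscript (May 2020), §0 «Monoids and Categories» p. 33
(«an isomorphism `C → D`» = an isomorphism class of equivalences; `Aut(C)`), §5 Corollary 5.3 (ii) p. 144 («the natural map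
`Isom(¹𝔉, ²𝔉) → Isom(¹𝔇, ²𝔇)` is bijective»; its printed proof, p. 144 l. 33–36, is «follows immediately from
[AbsTopIII], Proposition 3.2, (iv); 4.2, (i)»), and the argument PRINTED FOR (iv) («Finally, we consider assertion (iv)»,
p. 144 l. 37 – p. 145 l. 8: «surjectivity follows immediately from the construction … it remains to verify injectivity …
let `α ∈ Ker(Aut(ℱ̲_v) → Aut(𝒟_v))` … lies over the identity self-equivalence of `𝒟_v`»), whose two-halves SHAPE this file
transposes to the (ii) slots (doc-only v2, referee defect F-S15-2: the quoted lines belong to the proof of (iv), not of (ii)),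
Definition 5.2 (i) p. 134 (the `ℱ`-prime-strip datum `‡ℱ_v`, «a category `‡𝒞_v` which admits an
equivalence of categories `‡𝒞_v ⥲ 𝒞_v`») ([IUTchI] Cor 5.3 (ii) p.144) [claim: Mochizuki2012, status: disputed] (D-0012 claim
key, series status DISPUTED — this file is §0 VOCABULARY over abc-iut-L5-t4's `ConventionsCatIsomorphismGroup/Kinds`
(p491065/p492186); nothing of the series is asserted; no side is taken on [IUTchIII] Cor. 3.12).

## What this file builds (cell abc-iut, L5 BASE-MERGE RACE of 2026-08-27T03:53:32Z, racer B «minimal interface record»)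

By abc-iut-L5-t4's `PMBaseKit.FKit.isomFtoDBijective_iff_model` (p409092) the cone token `IUTchI:Cor5.3(ii)` at a kit reads, at
each index `x`, ONLY the slot ⟨`FAmb x`, `fModel x`, `toD x : FAmb x ⥤ K.Amb x`, `toD_model x`⟩ and asks that
`α ↦ (toD x).mapIso α` be bijective on automorphisms of `fModel x`.  abc-iut-L5-t4's design F1 (`ConventionsCatIsomorphismKinds`)
makes the slot the one-object kind `SingleObj (Aut(𝒞_v))` with base functor `kindFunctor` INTO `SingleObj (Aut(𝒟_v))`; but the
kit of record (`baseKitThetaNFOfBadPairs`, abc-iut-w5-d129 p491670) has a FIXED ambient `K.Amb x` (the Π-avatar `ThetaAmb`) whose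
automorphism group of the model `𝒟_v̲` is NOT `Aut(𝒟_v)` in the §0 sense, and there is no natural map `Aut(𝒟_v) → Aut_{Amb}(𝒟_v̲)`.
The record below is the slot that DOES land in a given ambient `A ∋ a` while still CARRYING the Frobenioid's isomorphisms:

* `CatIsomorphism.LiesOverClass p c b` — for a structure functor `p : C ⥤ B` (a Frobenioid over its base, [FrdI] Def 1.3): the
  §0-isomorphism `c ∈ Aut(C)` LIES OVER `b ∈ Aut(B)` (some/any representatives are related by t4's `LiesUnder`, [FrdI] Cor 4.11 (iv));
  closed under `1`, `*`, `⁻¹` (`liesOverClass_one`, `LiesOverClass.mul/inv`).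
* `CatIsomorphism.liftSubgroup p a ρ ≤ Aut a × Aut(C)` — given `ρ : Aut a →* Aut(B)` (ambient automorphisms of the base-object-in-play
  `a` READ AS §0-isomorphisms of the base category), the pairs `(n, c)` with `c` lying over `ρ n`: the FIBRE PRODUCT
  `Aut a ×_{Aut(B)} Aut(C)` in relation form (no `descend`, hence no `HasUnder`/`UnderUnique` binder is needed to DEFINE it).
* `CatIsomorphism.liftKindToAmb p a ρ : SingleObj ↥(liftSubgroup p a ρ) ⥤ A` — the slot's base functor: `⋆ ↦ a`, `(n, c) ↦ n`;
  `liftKindToAmb_obj` is `rfl`, so a kit using this slot has `toD_model := Iso.refl _`.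
* READING OF THE MODEL CASE (theorems): `mapIso_liftKindToAmb_bijective_iff` — «`α ↦ toD(α)` bijective on `Aut(⋆)`» ⟺
  `LiftsAll p a ρ` (every ambient automorphism of `a` has a §0-isomorphism of `C` over it — print's surjectivity half, «from the
  construction») ∧ `KernelRigid p` (a §0-isomorphism of `C` over the identity is the identity — print's injectivity half), and
  `kernelRigid_iff_rigidOverBase` rewriting the latter as `RigidOverBase p` : «every self-equivalence `Ψ` of `C` lying under
  `𝟭_B` satisfies `Ψ ≅ 𝟭_C`» — EXACTLY the conclusion shape of the [FrdI]-level rigidity rows (abc-iut-L1-t7 S2/S2′ p491743,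
  abc-iut-L5-t4 `Cor53.descend_injective_model_of_monoidRigid` p493191).  Also `liftFst_surjective_iff_liftsAll`,
  `liftFst_injective_iff_kernelRigid` (group-hom forms).

No instance beyond Mathlib's (`Aut`, `Subgroup`, `Prod`) and t4's `CatAut.group`; no notation; no `Prop` fact of the series;
binders ≠ facts; typed ≠ inhabited ≠ proved.  The genuine good-place slot of [IUTchI] Ex 3.3 over the kit of record (the
instance of this record at `GoodLocalFrobenioid.ofGalois`) is the companion `GenuineFKitMergeInputsSlots.lean`.
-/

namespace Literature.IUT.HodgeTheaters

open CategoryTheory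

universe v₁ v₂ v₃ u₁ u₂ u₃

namespace CatIsomorphism

section LiesOverClass

variable {C : Type u₁} [Category.{v₁} C] {B : Type u₂} [Category.{v₂} B] (p : C ⥤ B)

/-- **«`c` lies over `b`» for §0-isomorphisms** `c ∈ Aut(C)`, `b ∈ Aut(B)` relative to the structure functor `p : C → B`
([FrdI] Cor 4.11 (iv): the 1-commutative square `Ψ ⋙ p ≅ p ⋙ Θ`; [IUTchI] Cor 5.3 «`ⁱ𝔇` the `𝒟`-prime-strip associated to
`ⁱ𝔉`»): some (equivalently — `liesOverClass_mk_iff` — any) representatives `Ψ` of `c` and `Θ` of `b` admit a `LiesUnder p p Ψ Θ`.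
([IUTchI] Cor 5.3 p.144) [claim: Mochizuki2012, status: disputed] -/
def LiesOverClass (c : CatAut C) (b : CatAut B) : Prop :=
  ∃ (Ψ : C ≌ C) (Θ : B ≌ B), CatIsomorphism.mk Ψ = c ∧ CatIsomorphism.mk Θ = b ∧ Nonempty (LiesUnder p p Ψ Θ)

variable {p}

/-- On representatives, `LiesOverClass` is `LiesUnder` (invariance of `LiesUnder` under isomorphism of either equivalence,
abc-iut-L5-t4 `LiesUnder.ofIsoUpper/ofIsoLower`). ([IUTchI] Cor 5.3 p.144) [claim: Mochizuki2012, status: disputed] -/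
theorem liesOverClass_mk_iff (Ψ : C ≌ C) (Θ : B ≌ B) :
    LiesOverClass p (CatIsomorphism.mk Ψ) (CatIsomorphism.mk Θ) ↔ Nonempty (LiesUnder p p Ψ Θ) := by
  constructor
  · rintro ⟨Ψ', Θ', hΨ, hΘ, ⟨h⟩⟩
    obtain ⟨i⟩ := (CatIsomorphism.mk_eq_mk_iff Ψ' Ψ).1 hΨ
    obtain ⟨j⟩ := (CatIsomorphism.mk_eq_mk_iff Θ' Θ).1 hΘ
    exact ⟨(h.ofIsoUpper i).ofIsoLower j⟩
  · intro h
    exact ⟨Ψ, Θ, rfl, rfl, h⟩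

variable (p) in
/-- The identity lies over the identity. ([IUTchI] Cor 5.3 p.144) [claim: Mochizuki2012, status: disputed] -/
theorem liesOverClass_one : LiesOverClass p (1 : CatAut C) (1 : CatAut B) := by
  rw [CatAut.one_def, CatAut.one_def, refl_eq_mk, refl_eq_mk, liesOverClass_mk_iff]
  exact ⟨LiesUnder.refl p⟩

/-- `LiesOverClass` is closed under the group laws of `Aut(C)`, `Aut(B)`: products (pasting of squares, t4's
`LiesUnder.trans`). ([IUTchI] Cor 5.3 p.144) [claim: Mochizuki2012, status: disputed] -/
theorem LiesOverClass.mul {c c' : CatAut C} {b b' : CatAut B} (h : LiesOverClass p c b) (h' : LiesOverClass p c' b') :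
    LiesOverClass p (c * c') (b * b') := by
  obtain ⟨Ψ, Θ, rfl, rfl, ⟨h⟩⟩ := h
  obtain ⟨Ψ', Θ', rfl, rfl, ⟨h'⟩⟩ := h'
  rw [CatAut.mul_def, CatAut.mul_def, mk_comp_mk, mk_comp_mk, liesOverClass_mk_iff]
  exact ⟨h'.trans h⟩

/-- … and inverses (inverting the square, t4's `nonempty_liesUnder_symm`). ([IUTchI] Cor 5.3 p.144) [claim: Mochizuki2012, status: disputed] -/
theorem LiesOverClass.inv {c : CatAut C} {b : CatAut B} (h : LiesOverClass p c b) : LiesOverClass p c⁻¹ b⁻¹ := by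
  obtain ⟨Ψ, Θ, rfl, rfl, h⟩ := h
  rw [CatAut.inv_def, CatAut.inv_def, symm_mk, symm_mk, liesOverClass_mk_iff]
  exact nonempty_liesUnder_symm h

/-! ### The two halves of Cor 5.3 (ii)'s model case in this currency -/

variable (p)

/-- **INJECTIVITY HALF, class form**: a §0-isomorphism of `C` lying over the identity of `B` IS the identity («let
`α ∈ Ker(Aut(ℱ̲_v) → Aut(𝒟_v))` … then `α` is the identity», the argument printed for (iv), p. 144 l. 43 – p. 145 l. 8,
transposed; the content of the [FrdI]-level rigidity rows).
A PREDICATE on `p` (definition with parameters), not a named fact. ([IUTchI] Cor 5.3 p.144) [claim: Mochizuki2012, status: disputed] -/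
def KernelRigid : Prop := ∀ c : CatAut C, LiesOverClass p c 1 → c = 1

/-- **INJECTIVITY HALF, representative form** (the shape the rigidity rows deliver, cf. t4's
`descend_injective_of_kernel_trivial`): every self-equivalence `Ψ` of `C` lying under the identity self-equivalence of `B`
satisfies `Ψ ≅ 𝟭_C`. A PREDICATE on `p`, not a named fact. ([IUTchI] Cor 5.3 p.144) [claim: Mochizuki2012, status: disputed] -/
def RigidOverBase : Prop :=
  ∀ Ψ : C ≌ C, Nonempty (LiesUnder p p Ψ (CategoryTheory.Equivalence.refl (C := B))) → Nonempty (Ψ.functor ≅ 𝟭 C)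

variable {p}

/-- The two injectivity forms agree. ([IUTchI] Cor 5.3 p.144) [claim: Mochizuki2012, status: disputed] -/
theorem kernelRigid_iff_rigidOverBase : KernelRigid p ↔ RigidOverBase p := by
  constructor
  · intro h Ψ hΨ
    have h1 : CatIsomorphism.mk Ψ = (1 : CatAut C) := by
      refine h _ ?_
      rw [CatAut.one_def, refl_eq_mk, liesOverClass_mk_iff]
      exact hΨ
    rw [CatAut.one_def, refl_eq_mk] at h1
    exact (CatIsomorphism.mk_eq_mk_iff _ _).1 h1
  · intro h c hc
    obtain ⟨Ψ, Θ, rfl, hΘ, ⟨hL⟩⟩ := hc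
    rw [CatAut.one_def, refl_eq_mk] at hΘ ⊢
    obtain ⟨j⟩ := (CatIsomorphism.mk_eq_mk_iff _ _).1 hΘ
    obtain ⟨i⟩ := h Ψ ⟨hL.ofIsoLower j⟩
    exact sound i

end LiesOverClass

/-! ### The lift kind over a given ambient -/

section LiftKind

variable {C : Type u₁} [Category.{v₁} C] {B : Type u₂} [Category.{v₂} B] (p : C ⥤ B)
  {A : Type u₃} [Category.{v₃} A] (a : A) (ρ : Aut a →* CatAut B)

/-- **The lift subgroup** `Aut a ×_{Aut(B)} Aut(C)` (relation form): pairs `(n, c)` of an ambient automorphism `n` of the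
base-object-in-play `a` and a §0-isomorphism `c` of `C` lying over `ρ n`, where `ρ : Aut a →* Aut(B)` reads ambient
automorphisms as §0-isomorphisms of the base category.  This is «an isomorphism `‡ℱ_v ⥲ ‡ℱ_v` together with the
isomorphism of `‡𝒟_v` it induces» (Def 5.2 (i), Rmk 5.2.1 (i)) in a kit whose `𝒟`-side lives in a fixed ambient.
([IUTchI] Def 5.2 (i) p.134) [claim: Mochizuki2012, status: disputed] -/
def liftSubgroup : Subgroup (Aut a × CatAut C) where
  carrier := {x | LiesOverClass p x.2 (ρ x.1)}
  one_mem' := by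
    change LiesOverClass p 1 (ρ 1)
    rw [map_one]
    exact liesOverClass_one p
  mul_mem' := by
    intro x y hx hy
    change LiesOverClass p (x.2 * y.2) (ρ (x.1 * y.1))
    rw [map_mul]
    exact hx.mul hy
  inv_mem' := by
    intro x hx
    change LiesOverClass p x.2⁻¹ (ρ x.1⁻¹)
    rw [map_inv]
    exact hx.inv

variable {p a ρ} in
/-- Membership in the lift subgroup. ([IUTchI] Def 5.2 (i) p.134) [claim: Mochizuki2012, status: disputed] -/
theorem mem_liftSubgroup_iff (x : Aut a × CatAut C) : x ∈ liftSubgroup p a ρ ↔ LiesOverClass p x.2 (ρ x.1) := Iff.rfl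

/-- The projection «isomorphism of `‡ℱ_v` ↦ the induced isomorphism of `‡𝒟_v`» as a homomorphism to `Aut a`
(Rmk 5.2.1 (i) on isomorphisms). ([IUTchI] Rmk 5.2.1 (i) p.143) [claim: Mochizuki2012, status: disputed] -/
def liftFst : ↥(liftSubgroup p a ρ) →* Aut a := (MonoidHom.fst (Aut a) (CatAut C)).comp (liftSubgroup p a ρ).subtype

/-- `liftFst` on elements. ([IUTchI] Rmk 5.2.1 (i) p.143) [claim: Mochizuki2012, status: disputed] -/
@[simp] theorem liftFst_apply (g : ↥(liftSubgroup p a ρ)) : liftFst p a ρ g = g.1.1 := rfl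

/-- **The lift kind's base functor** `SingleObj (Aut a ×_{Aut(B)} Aut(C)) ⥤ A`: the unique object goes to `a`, a pair `(n, c)`
to `n` — the slot functor `toD x : FAmb x ⥤ K.Amb x` of an `ℱ`-prime-strip kit (Rmk 5.2.1 (i) «`𝔉 ↦ 𝔇`») for the one-object
kind of `C` placed over the given ambient. ([IUTchI] Rmk 5.2.1 (i) p.143) [claim: Mochizuki2012, status: disputed] -/
def liftKindToAmb : SingleObj ↥(liftSubgroup p a ρ) ⥤ A :=
  SingleObj.functor ((Aut.toEnd a).comp (liftFst p a ρ))

/-- The lift kind's base functor sends the unique object to `a` (definitionally; a kit using this slot has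
`toD_model := Iso.refl _`). ([IUTchI] Rmk 5.2.1 (i) p.143) [claim: Mochizuki2012, status: disputed] -/
theorem liftKindToAmb_obj (X : SingleObj ↥(liftSubgroup p a ρ)) : (liftKindToAmb p a ρ).obj X = a := rfl

/-- On morphisms the base functor is the first projection. ([IUTchI] Rmk 5.2.1 (i) p.143) [claim: Mochizuki2012, status: disputed] -/
theorem liftKindToAmb_map (g : SingleObj.star ↥(liftSubgroup p a ρ) ⟶ SingleObj.star ↥(liftSubgroup p a ρ)) :
    (liftKindToAmb p a ρ).map g = (show ↥(liftSubgroup p a ρ) from g).1.1.hom := rfl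

/-- **SURJECTIVITY HALF**: every ambient automorphism of `a` has a §0-isomorphism of `C` lying over it («surjectivity follows
immediately from the construction of `ℱ̲_v`», the argument printed for (iv), p. 144 l. 41–43, transposed — at a genuine slot this
is the FUNCTORIALITY of the Frobenioid
construction in the ambient's transporters). A PREDICATE, not a named fact. ([IUTchI] Cor 5.3 p.144) [claim: Mochizuki2012, status: disputed] -/
def LiftsAll : Prop := ∀ n : Aut a, ∃ c : CatAut C, LiesOverClass p c (ρ n)

variable {p a ρ}

/-- `liftFst` is surjective iff every ambient automorphism lifts. ([IUTchI] Cor 5.3 p.144) [claim: Mochizuki2012, status: disputed] -/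
theorem liftFst_surjective_iff_liftsAll : Function.Surjective (liftFst p a ρ) ↔ LiftsAll p a ρ := by
  constructor
  · intro h n
    obtain ⟨g, hg⟩ := h n
    refine ⟨g.1.2, ?_⟩
    have hm := (mem_liftSubgroup_iff g.1).1 g.2
    rw [liftFst_apply] at hg
    rwa [hg] at hm
  · intro h n
    obtain ⟨c, hc⟩ := h n
    exact ⟨⟨(n, c), hc⟩, rfl⟩

/-- `liftFst` is injective iff the only §0-isomorphism of `C` over the identity is the identity.
([IUTchI] Cor 5.3 p.144) [claim: Mochizuki2012, status: disputed] -/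
theorem liftFst_injective_iff_kernelRigid : Function.Injective (liftFst p a ρ) ↔ KernelRigid p := by
  rw [injective_iff_map_eq_one]
  constructor
  · intro h c hc
    have hmem : ((1 : Aut a), c) ∈ liftSubgroup p a ρ := by
      rw [mem_liftSubgroup_iff, map_one]
      exact hc
    have h1 := h ⟨(1, c), hmem⟩ rfl
    exact congrArg (fun g : ↥(liftSubgroup p a ρ) => g.1.2) h1
  · intro h g hg
    rw [liftFst_apply] at hg
    have hm := (mem_liftSubgroup_iff g.1).1 g.2
    rw [hg, map_one] at hm
    have h2 := h _ hm
    exact Subtype.ext (Prod.ext hg h2)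

/-- The map of the model case, `α ↦ toD(α)` on automorphisms of the unique object, is `liftFst` transported along Mathlib's
`G ≃ Aut(⋆)`. [folklore] -/
private theorem mapIso_liftKindToAmb_toAut (g : ↥(liftSubgroup p a ρ)) :
    (liftKindToAmb p a ρ).mapIso ((toUnits.trans (Units.toAut ↥(liftSubgroup p a ρ))).toEquiv g) = liftFst p a ρ g := by
  ext
  rfl

/-- **THE MODEL CASE OF [IUTchI] Cor 5.3 (ii) AT A LIFT-KIND SLOT, READ OUT.**  For the slot
⟨`SingleObj (Aut a ×_{Aut(B)} Aut(C))`, `⋆`, `liftKindToAmb`, `Iso.refl`⟩ the hypothesis of abc-iut-L5-t4's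
`FKit.isomFtoDBijective_of_model` at this index — «`α ↦ toD(α)` is bijective on automorphisms of the reference object» — holds
IFF every ambient automorphism lifts (`LiftsAll`) AND the kernel is trivial (`KernelRigid`): surjectivity half ∧ injectivity half
of the printed proof, each to be supplied BY NAME; no tautology. ([IUTchI] Cor 5.3 (ii) p.144) [claim: Mochizuki2012, status: disputed] -/
theorem mapIso_liftKindToAmb_bijective_iff :
    Function.Bijective (fun α : SingleObj.star ↥(liftSubgroup p a ρ) ≅ SingleObj.star ↥(liftSubgroup p a ρ) =>
        (show a ≅ a from (liftKindToAmb p a ρ).mapIso α)) ↔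
      LiftsAll p a ρ ∧ KernelRigid p := by
  set G := ↥(liftSubgroup p a ρ)
  set e : G ≃ (SingleObj.star G ≅ SingleObj.star G) := (toUnits.trans (Units.toAut G)).toEquiv with he
  set F : (SingleObj.star G ≅ SingleObj.star G) → (a ≅ a) := fun α => (liftKindToAmb p a ρ).mapIso α with hF
  have h1 : ∀ g, F (e g) = liftFst p a ρ g := fun g => mapIso_liftKindToAmb_toAut g
  have hf : (liftFst p a ρ : G → Aut a) = F ∘ e := by
    funext g
    exact (h1 g).symm
  rw [← liftFst_surjective_iff_liftsAll, ← liftFst_injective_iff_kernelRigid (a := a) (ρ := ρ), hf]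
  constructor
  · intro h
    exact ⟨h.2.comp e.surjective, h.1.comp e.injective⟩
  · rintro ⟨hs, hi⟩
    have hF' : F = (F ∘ e) ∘ e.symm := by
      funext α
      simp
    rw [hF']
    exact ⟨hi.comp e.symm.injective, hs.comp e.symm.surjective⟩

/-- The same with the injectivity half in representative form (`RigidOverBase`, the shape the [FrdI]-level rigidity rows
deliver). ([IUTchI] Cor 5.3 (ii) p.144) [claim: Mochizuki2012, status: disputed] -/
theorem mapIso_liftKindToAmb_bijective_iff' :
    Function.Bijective (fun α : SingleObj.star ↥(liftSubgroup p a ρ) ≅ SingleObj.star ↥(liftSubgroup p a ρ) =>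
        (show a ≅ a from (liftKindToAmb p a ρ).mapIso α)) ↔
      LiftsAll p a ρ ∧ RigidOverBase p := by
  rw [mapIso_liftKindToAmb_bijective_iff, kernelRigid_iff_rigidOverBase]

/-- NON-VACUITY of the record (KIT-RULE): over ANY data the lift subgroup is inhabited by `(1, 1)`.
([IUTchI] Def 5.2 (i) p.134) [claim: Mochizuki2012, status: disputed] -/
theorem one_mem_liftSubgroup : ((1 : Aut a), (1 : CatAut C)) ∈ liftSubgroup p a ρ :=
  (liftSubgroup p a ρ).one_mem

end LiftKind

end CatIsomorphism

end Literature.IUT.HodgeTheaters
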